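import Summits.CriticalPhenomena.PercolationContinuityZ3.Theorems.PercNearOneGluingNoHeavyQuantFarSunLawDefs
import Summits.CriticalPhenomena.PercolationContinuityZ3.Theorems.PercNearOneGluingNoHeavyQuantFarHairyCycle
import Literature.Probability.LatticeModels.ProdBernoulliBK
import HarnessLib

/-!
# FAR beyond trees: the SUN-LAW DICTIONARY I — atoms of the sun graph `C_{K+1}`: coordinates, the reached set on an atom,
# cylinder probabilities and the partition (all `K ≥ 2`)

builds on p205010 (kernel theorem, internal audit signed; external expert review pending)

Support file (`--supports stmt-CriticalPhenomena-4575`), seat `prim-cert-1` (gen 20); QUANT lane rung R8, front "FAR beyond trees" (lead g22).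
Vocabulary: `…QuantFarSunLawDefs` (`hairW`, `arcW`, `arcIx`, `cov`, `sunG`, `sunH`, `hairSet`, `closedSet`, `firstClosed`, `lastClosed`, `atom`).
For a configuration `ω` of the pairs of `Fin (2K+1)`: its open-hair set `hairSet K ω`, and the first / last closed cycle edge
`firstClosed K ω ≤ lastClosed K ω ≤ K` (both `K+1` if every cycle edge is open) are almost-sure coordinates:

* `mem_atom_self`, `coords_mem`, `eq_of_mem_atom`, `atom_disjoint` — every `ω` lies in the atom of its coordinates, the coordinates form an
  index of `(range K).powerset ×ˢ arcIx K`, an atom with admissible index determines the coordinates, distinct atoms are disjoint: **the atoms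
  partition the configuration space**;
* `carried_of_good`, `reached_eq_of_mem_atom` — for `q` vanishing off the sun graph, a configuration all of whose open pairs have non-zero weight is
  carried by the sun graph, and **on the atom `(Q, l, l')` it reaches exactly the tips `Q ∩ cov K l l'`** (arc characterisation
  `HairyCycle.mem_openConn_tip_iff`: clockwise to position `k+1` iff `k < l`, counter-clockwise iff `l' ≤ k`);
* `real_atom_eq` — **`P_q(atom Q l l') = hairW K (sunH K q) Q · arcW K (sunG K q) l l'`** (a cylinder probability, `prodBernoulli_real_cylinder_pattern`);
* `real_eq_sum_inter_atom` — **`P_q(E) = Σ_{(Q,(l,l'))} P_q(E ∩ atom Q l l')`** for every event `E`;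
* `real_congr_of_good` — events agreeing on `{ω | ∀ e ∈ ω, q e ≠ 0}` have the same probability (the complement is null).
The law of the reached-tip set (`sunLaw`) and the marginals follow in `…QuantFarSunLaw`.  No sorries; standard axioms.
[cite: Grimmett1999, §1.3 p. 10; §2.2] (product measure, cylinder probabilities); bookkeeping [this work].
-/

noncomputable section

namespace Summit.CriticalPhenomena.PercolationContinuityZ3.Theorems.HairyCycle

open Finset MeasureTheory
open Literature.Probability.Percolation Literature.Probability.LatticeModels
open Summit.CriticalPhenomena.PercolationContinuityZ3.Theorems.AdditiveGluing.Negative.Cert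
open Summit.CriticalPhenomena.PercolationContinuityZ3.Theorems.TwoCopy
open scoped Classical

variable {K : ℕ}

/-! ## Coordinates and atoms -/

/-- Every configuration lies in the atom of its own coordinates. [this work] -/
theorem mem_atom_self (ω : Set (Sym2 (Fin (2 * K + 1)))) : ω ∈ atom K (hairSet K ω) (firstClosed K ω) (lastClosed K ω) := by
  refine ⟨fun k hk => ?_, fun m hm hnb => ?_⟩
  · unfold hairSet
    rw [Finset.mem_filter, Finset.mem_range]
    exact ⟨fun h => ⟨hk, h⟩, fun h => h.2⟩
  · by_cases hne : (closedSet K ω).Nonempty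
    · have hlo : firstClosed K ω = (closedSet K ω).min' hne := by unfold firstClosed; rw [dif_pos hne]
      have hhi : lastClosed K ω = (closedSet K ω).max' hne := by unfold lastClosed; rw [dif_pos hne]
      rw [hlo, hhi] at hnb ⊢
      constructor
      · intro hopen
        by_contra hcon
        push Not at hcon
        -- `m` lies in `[min, max]` but is open, while not strictly between: so `m = min` or `m = max`, both closed
        have hmem : m ∉ closedSet K ω := by
          unfold closedSet; rw [Finset.mem_filter]; exact fun h => h.2 hopen
        rcases Nat.eq_or_lt_of_le hcon.1 with h1 | h1
        · exact hmem (h1 ▸ Finset.min'_mem _ hne)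
        · rcases Nat.eq_or_lt_of_le hcon.2 with h2 | h2
          · exact hmem (h2.symm ▸ Finset.max'_mem _ hne)
          · exact hnb ⟨h1, h2⟩
      · intro h
        by_contra hclosed
        have hmem : m ∈ closedSet K ω := by
          unfold closedSet; rw [Finset.mem_filter, Finset.mem_range]; exact ⟨by omega, hclosed⟩
        rcases h with h | h
        · exact absurd (Finset.min'_le _ _ hmem) (not_le.2 h)
        · exact absurd (Finset.le_max' _ _ hmem) (not_le.2 h)
    · have hlo : firstClosed K ω = K + 1 := by unfold firstClosed; rw [dif_neg hne]
      have hhi : lastClosed K ω = K + 1 := by unfold lastClosed; rw [dif_neg hne]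
      rw [hlo, hhi]
      constructor
      · intro _; left; omega
      · intro _
        by_contra hclosed
        exact hne ⟨m, by unfold closedSet; rw [Finset.mem_filter, Finset.mem_range]; exact ⟨by omega, hclosed⟩⟩

/-- The coordinates of a configuration form an admissible index. [this work] -/
theorem coords_mem (ω : Set (Sym2 (Fin (2 * K + 1)))) :
    (hairSet K ω, (firstClosed K ω, lastClosed K ω)) ∈ (range K).powerset ×ˢ arcIx K := by
  rw [Finset.mem_product, Finset.mem_powerset]
  refine ⟨Finset.filter_subset _ _, mem_arcIx.2 ?_⟩
  by_cases hne : (closedSet K ω).Nonempty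
  · have hlo : firstClosed K ω = (closedSet K ω).min' hne := by unfold firstClosed; rw [dif_pos hne]
    have hhi : lastClosed K ω = (closedSet K ω).max' hne := by unfold lastClosed; rw [dif_pos hne]
    left
    refine ⟨by rw [hlo, hhi]; exact Finset.min'_le _ _ (Finset.max'_mem _ hne), ?_⟩
    have := Finset.max'_mem _ hne
    unfold closedSet at this
    rw [Finset.mem_filter, Finset.mem_range] at this
    show lastClosed K ω ≤ K
    rw [hhi]; unfold closedSet; omega
  · right
    constructor
    · show firstClosed K ω = K + 1
      unfold firstClosed; rw [dif_neg hne]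
    · show lastClosed K ω = K + 1
      unfold lastClosed; rw [dif_neg hne]

/-- An atom with admissible index determines the coordinates of its members. [this work] -/
theorem eq_of_mem_atom {Q : Finset ℕ} {l l' : ℕ} (hQ : Q ⊆ range K) (hll : (l, l') ∈ arcIx K)
    {ω : Set (Sym2 (Fin (2 * K + 1)))} (hω : ω ∈ atom K Q l l') :
    hairSet K ω = Q ∧ firstClosed K ω = l ∧ lastClosed K ω = l' := by
  obtain ⟨hh, hc⟩ := hω
  refine ⟨?_, ?_⟩
  · unfold hairSet
    ext k
    rw [Finset.mem_filter, Finset.mem_range]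
    constructor
    · rintro ⟨hk, hmem⟩; exact (hh k hk).1 hmem
    · intro hk
      have hkK := Finset.mem_range.1 (hQ hk)
      exact ⟨hkK, (hh k hkK).2 hk⟩
  · rcases mem_arcIx.1 hll with ⟨h1, h2⟩ | ⟨h1, h2⟩
    · simp only at h1 h2
      -- `l` and `l'` are closed, everything closed lies in `[l, l']`
      have hlmem : l ∈ closedSet K ω := by
        unfold closedSet; rw [Finset.mem_filter, Finset.mem_range]
        refine ⟨by omega, fun hopen => ?_⟩
        have := (hc l (by omega) (fun h => absurd h.1 (lt_irrefl l))).1 hopen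
        omega
      have hl'mem : l' ∈ closedSet K ω := by
        unfold closedSet; rw [Finset.mem_filter, Finset.mem_range]
        refine ⟨by omega, fun hopen => ?_⟩
        have := (hc l' h2 (fun h => absurd h.2 (lt_irrefl l'))).1 hopen
        omega
      have hne : (closedSet K ω).Nonempty := ⟨l, hlmem⟩
      have hbetween : ∀ m ∈ closedSet K ω, l ≤ m ∧ m ≤ l' := by
        intro m hm
        unfold closedSet at hm
        rw [Finset.mem_filter, Finset.mem_range] at hm
        by_contra hcon
        push Not at hcon
        have hnot : ¬ (l < m ∧ m < l') := fun h => by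
          by_cases hlm : l ≤ m
          · have := hcon hlm; omega
          · omega
        have : m < l ∨ l' < m := by
          by_cases hlm : l ≤ m
          · right; exact hcon hlm
          · left; omega
        exact hm.2 ((hc m (by omega) hnot).2 this)
      have hlo : firstClosed K ω = (closedSet K ω).min' hne := by unfold firstClosed; rw [dif_pos hne]
      have hhi : lastClosed K ω = (closedSet K ω).max' hne := by unfold lastClosed; rw [dif_pos hne]
      constructor
      · rw [hlo]
        exact le_antisymm (Finset.min'_le _ _ hlmem) ((hbetween _ (Finset.min'_mem _ hne)).1)
      · rw [hhi]
        exact le_antisymm ((hbetween _ (Finset.max'_mem _ hne)).2) (Finset.le_max' _ _ hl'mem)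
    · simp only at h1 h2
      subst h1; subst h2
      have hempty : ¬ (closedSet K ω).Nonempty := by
        rintro ⟨m, hm⟩
        unfold closedSet at hm
        rw [Finset.mem_filter, Finset.mem_range] at hm
        exact hm.2 ((hc m (by omega) (fun h => by omega)).2 (Or.inl hm.1))
      constructor
      · unfold firstClosed; rw [dif_neg hempty]
      · unfold lastClosed; rw [dif_neg hempty]

/-- Atoms with distinct admissible indices are disjoint. [this work] -/
theorem atom_disjoint {Q Q' : Finset ℕ} {l l' m m' : ℕ} (hQ : Q ⊆ range K) (hll : (l, l') ∈ arcIx K)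
    (hQ' : Q' ⊆ range K) (hmm : (m, m') ∈ arcIx K) (hne : (Q, (l, l')) ≠ (Q', (m, m'))) :
    Disjoint (atom K Q l l') (atom K Q' m m') := by
  rw [Set.disjoint_left]
  intro ω h1 h2
  obtain ⟨a1, a2, a3⟩ := eq_of_mem_atom hQ hll h1
  obtain ⟨b1, b2, b3⟩ := eq_of_mem_atom hQ' hmm h2
  exact hne (by rw [← a1, ← a2, ← a3, b1, b2, b3])

/-! ## The reached set on an atom -/

/-- A configuration of a weight vanishing off the sun graph is almost surely carried by it: here, the pointwise statement for
configurations all of whose open pairs have non-zero weight. [this work] -/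
theorem carried_of_good (q : Sym2 (Fin (2 * K + 1)) → unitInterval) (hq : VanishesOff q (sunEs K))
    {ω : Set (Sym2 (Fin (2 * K + 1)))} (hω : ∀ e ∈ ω, q e ≠ 0) :
    Carried (K + 1) (sunCyc K) K sunBase (sunTip K) ω := by
  intro u v huv he
  have hmem : s(u, v) ∈ Eset (sunEs K) := by
    by_contra hnot
    exact hω _ he (hq _ (fun hd => huv (Sym2.mk_isDiag_iff.1 hd)) hnot)
  exact (mem_Eset_sunEs_iff K _).1 hmem

/-- **On an atom with admissible index `(Q, l, l')`, a carried configuration reaches exactly the tips `Q ∩ cov l l'`.** [this work] -/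
theorem reached_eq_of_mem_atom (hK : 2 ≤ K) {Q : Finset ℕ} {l l' : ℕ} (hll : (l, l') ∈ arcIx K)
    {ω : Set (Sym2 (Fin (2 * K + 1)))} (hω : Carried (K + 1) (sunCyc K) K sunBase (sunTip K) ω) (hmem : ω ∈ atom K Q l l') :
    ((range K).filter fun k => ω ∈ openConn (sunCyc K 0) (sunTip K k)) = Q ∩ cov K l l' := by
  have HS := isHairyCycle_sun hK
  obtain ⟨hh, hc⟩ := hmem
  have hll' := mem_arcIx.1 hll
  simp only at hll'
  ext k
  rw [Finset.mem_filter, Finset.mem_range, Finset.mem_inter]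
  unfold cov
  rw [Finset.mem_filter, Finset.mem_range]
  constructor
  · rintro ⟨hk, hconn⟩
    have hRT := (mem_openConn_tip_iff (K + 1) (sunCyc K) K sunBase (sunTip K) HS.hL HS.hcyc HS.hbase HS.htip HS.hoff ω hω hk).1 hconn
    obtain ⟨hRC, hhair⟩ := hRT
    refine ⟨(hh k hk).1 hhair, hk, ?_⟩
    unfold sunBase at hRC
    rcases hRC with hcw | hccw
    · -- clockwise to position `k+1`: every edge `m ≤ k` is open, so `k < l`
      by_contra hcon
      push Not at hcon
      rcases hll' with ⟨h1, h2⟩ | ⟨h1, _⟩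
      · have hopen := hcw l (by omega)
        have := (hc l (by omega) (fun h => absurd h.1 (lt_irrefl l))).1 hopen
        omega
      · omega
    · -- counter-clockwise to position `k+1`: every edge `m ≥ k+1` is open, so `l' ≤ k`
      by_contra hcon
      push Not at hcon
      rcases hll' with ⟨_, h2⟩ | ⟨h1, h2⟩
      · have hopen := hccw l' (by omega) (by omega)
        have := (hc l' h2 (fun h => absurd h.2 (lt_irrefl l'))).1 hopen
        omega
      · omega
  · rintro ⟨hkQ, hk, hcov⟩
    refine ⟨hk, (mem_openConn_tip_iff (K + 1) (sunCyc K) K sunBase (sunTip K) HS.hL HS.hcyc HS.hbase HS.htip HS.hoff ω hω hk).2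
      ⟨?_, (hh k hk).2 hkQ⟩⟩
    unfold sunBase
    rcases hcov with h | h
    · left
      intro m hm
      exact (hc m (by omega) (fun h' => by omega)).2 (Or.inl (by omega))
    · right
      intro m hm hmK
      exact (hc m (by omega) (fun h' => by omega)).2 (Or.inr (by omega))

/-! ## The probability of an atom -/

/-- **Cylinder probability of an atom**: `P_q(atom Q l l') = hairW Q · arcW l l'` (`Q ⊆ [0, K)`). [this work] -/
theorem real_atom_eq (hK : 2 ≤ K) (q : Sym2 (Fin (2 * K + 1)) → unitInterval) {Q : Finset ℕ} (hQ : Q ⊆ range K) (l l' : ℕ) :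
    (prodBernoulli q).real (atom K Q l l') = hairW K (sunH K q) Q * arcW K (sunG K q) l l' := by
  have HS := isHairyCycle_sun hK
  set hE : ℕ → Sym2 (Fin (2 * K + 1)) := hairE (sunCyc K) sunBase (sunTip K) with hhE
  set cE : ℕ → Sym2 (Fin (2 * K + 1)) := cycE (K + 1) (sunCyc K) with hcE
  set S : Finset ℕ := (range (K + 1)).filter (fun m => ¬ (l < m ∧ m < l')) with hS
  set Fh : Finset (Sym2 (Fin (2 * K + 1))) := (range K).image hE with hFh
  set Fc : Finset (Sym2 (Fin (2 * K + 1))) := S.image cE with hFc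
  -- the open pattern
  set pat : Sym2 (Fin (2 * K + 1)) → Bool := fun e =>
    decide (e ∈ Q.image hE ∨ e ∈ ((range (K + 1)).filter fun m => m < l ∨ l' < m).image cE) with hpat
  have hinjh : Set.InjOn hE (range K : Finset ℕ) := fun k hk k' hk' h =>
    hairE_inj HS (Finset.mem_range.1 hk) (Finset.mem_range.1 hk') h
  have hinjc : Set.InjOn cE S := fun m hm m' hm' h =>
    cycE_inj HS (by have := (Finset.mem_filter.1 hm).1; rw [Finset.mem_range] at this; exact this)
      (by have := (Finset.mem_filter.1 hm').1; rw [Finset.mem_range] at this; exact this) h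
  have hdisj : Disjoint Fh Fc := by
    rw [Finset.disjoint_left]
    intro e he he'
    rw [hFh, Finset.mem_image] at he
    rw [hFc, Finset.mem_image] at he'
    obtain ⟨k, hk, rfl⟩ := he
    obtain ⟨m, hm, hm'⟩ := he'
    have hmK : m < K + 1 := Finset.mem_range.1 (Finset.mem_filter.1 hm).1
    exact hairE_ne_cycE HS (Finset.mem_range.1 hk) hmK hm'.symm
  -- value of the pattern on hairs and on cycle edges
  have hpat_h : ∀ k, k < K → (pat (hE k) = true ↔ k ∈ Q) := by
    intro k hk
    rw [hpat, decide_eq_true_iff]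
    constructor
    · rintro (h | h)
      · rw [Finset.mem_image] at h
        obtain ⟨k', hk', hkk'⟩ := h
        rwa [← hairE_inj HS (Finset.mem_range.1 (hQ hk')) hk hkk']
      · rw [Finset.mem_image] at h
        obtain ⟨m, hm, hm'⟩ := h
        exact absurd hm'.symm (hairE_ne_cycE HS hk (Finset.mem_range.1 (Finset.mem_filter.1 hm).1))
    · intro h; exact Or.inl (Finset.mem_image_of_mem _ h)
  have hpat_c : ∀ m, m < K + 1 → (pat (cE m) = true ↔ (m < l ∨ l' < m)) := by
    intro m hm
    rw [hpat, decide_eq_true_iff]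
    constructor
    · rintro (h | h)
      · rw [Finset.mem_image] at h
        obtain ⟨k', hk', hkk'⟩ := h
        exact absurd hkk' (hairE_ne_cycE HS (Finset.mem_range.1 (hQ hk')) hm)
      · rw [Finset.mem_image] at h
        obtain ⟨m', hm', hmm'⟩ := h
        rw [Finset.mem_filter, Finset.mem_range] at hm'
        have hmeq : m' = m := cycE_inj HS hm'.1 hm hmm'
        rw [← hmeq]; exact hm'.2
    · intro h
      exact Or.inr (Finset.mem_image_of_mem _ (by rw [Finset.mem_filter, Finset.mem_range]; exact ⟨hm, h⟩))
  -- the atom is the cylinder with pattern `pat` on `Fh ∪ Fc`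
  have hcyl : atom K Q l l' = {ω | ∀ (e) (_ : e ∈ Fh ∪ Fc), e ∈ ω ↔ pat e = true} := by
    ext ω
    constructor
    · rintro ⟨hh, hc⟩ e he
      rcases Finset.mem_union.1 he with he | he
      · rw [hFh, Finset.mem_image] at he
        obtain ⟨k, hk, rfl⟩ := he
        rw [Finset.mem_range] at hk
        rw [hpat_h k hk]; exact hh k hk
      · rw [hFc, Finset.mem_image] at he
        obtain ⟨m, hm, rfl⟩ := he
        rw [Finset.mem_filter, Finset.mem_range] at hm
        rw [hpat_c m hm.1]; exact hc m (by omega) hm.2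
    · intro hω
      refine ⟨fun k hk => ?_, fun m hm hnb => ?_⟩
      · have := hω (hE k) (Finset.mem_union_left _ (Finset.mem_image_of_mem _ (Finset.mem_range.2 hk)))
        rwa [hpat_h k hk] at this
      · have := hω (cE m) (Finset.mem_union_right _
          (Finset.mem_image_of_mem _ (by rw [Finset.mem_filter, Finset.mem_range]; exact ⟨by omega, hnb⟩)))
        rwa [hpat_c m (by omega)] at this
  rw [hcyl, prodBernoulli_real_cylinder_pattern q (Fh ∪ Fc) (fun e => pat e.1),
    Finset.prod_coe_sort (Fh ∪ Fc) (fun e => if pat e = true then ((q e : unitInterval) : ℝ) else 1 - ((q e : unitInterval) : ℝ)),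
    Finset.prod_union hdisj, hFh, Finset.prod_image hinjh, hFc, Finset.prod_image hinjc]
  unfold hairW arcW
  congr 1
  · refine Finset.prod_congr rfl fun k hk => ?_
    rw [Finset.mem_range] at hk
    by_cases hkQ : k ∈ Q
    · rw [if_pos ((hpat_h k hk).2 hkQ), if_pos hkQ]; rfl
    · have : ¬ pat (hE k) = true := fun h => hkQ ((hpat_h k hk).1 h)
      rw [if_neg this, if_neg hkQ]; rfl
  · refine Finset.prod_congr rfl fun m hm => ?_
    have hmK : m < K + 1 := Finset.mem_range.1 (Finset.mem_filter.1 hm).1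
    by_cases hml : m < l ∨ l' < m
    · rw [if_pos ((hpat_c m hmK).2 hml), if_pos hml]; rfl
    · have : ¬ pat (cE m) = true := fun h => hml ((hpat_c m hmK).1 h)
      rw [if_neg this, if_neg hml]; rfl

/-! ## Almost-sure bookkeeping -/

/-- **Events agreeing on the good configurations have the same probability.**  The configurations containing a pair of weight `0`
form a null set, so two events that agree on `{ω | ∀ e ∈ ω, q e ≠ 0}` have equal `P_q`-probability. [folklore] -/
theorem real_congr_of_good (q : Sym2 (Fin (2 * K + 1)) → unitInterval) {X Y : Set (Set (Sym2 (Fin (2 * K + 1))))}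
    (h : ∀ ω : Set (Sym2 (Fin (2 * K + 1))), (∀ e ∈ ω, q e ≠ 0) → (ω ∈ X ↔ ω ∈ Y)) :
    (prodBernoulli q).real X = (prodBernoulli q).real Y := by
  set μ := prodBernoulli q with hμ
  set G : Set (Set (Sym2 (Fin (2 * K + 1)))) := {ω | ∀ e ∈ ω, q e ≠ 0} with hG
  have hGnull : μ.real Gᶜ = 0 := by
    set Z : Finset (Sym2 (Fin (2 * K + 1))) := univ.filter (fun e => q e = 0) with hZ
    have hsub : Gᶜ ⊆ {ω : Set (Sym2 (Fin (2 * K + 1))) | ∃ e ∈ Z, e ∈ ω} := by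
      intro ω hω
      have hω' : ¬ ∀ e ∈ ω, q e ≠ 0 := hω
      push Not at hω'
      obtain ⟨e, he, hwe⟩ := hω'
      exact ⟨e, Finset.mem_filter.2 ⟨Finset.mem_univ _, hwe⟩, he⟩
    have h1 : μ.real {ω : Set (Sym2 (Fin (2 * K + 1))) | ∃ e ∈ Z, e ∈ ω} ≤ ∑ e ∈ Z, (q e : ℝ) :=
      prodBernoulli_real_exists_mem_le_sum q Z
    have h2 : ∑ e ∈ Z, (q e : ℝ) = 0 := Finset.sum_eq_zero fun e he => by
      rw [Finset.mem_filter] at he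
      simp [he.2]
    exact le_antisymm ((measureReal_mono hsub (measure_ne_top _ _)).trans (h1.trans h2.le)) measureReal_nonneg
  have key : ∀ X Y : Set (Set (Sym2 (Fin (2 * K + 1)))), (∀ ω ∈ G, ω ∈ X → ω ∈ Y) → μ.real X ≤ μ.real Y := by
    intro X Y h
    have hsub : X ⊆ Y ∪ Gᶜ := fun ω hω => by
      by_cases hωG : ω ∈ G
      · exact Or.inl (h ω hωG hω)
      · exact Or.inr hωG
    calc μ.real X ≤ μ.real (Y ∪ Gᶜ) := measureReal_mono hsub (measure_ne_top _ _)
      _ ≤ μ.real Y + μ.real Gᶜ := measureReal_union_le _ _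
      _ = μ.real Y := by rw [hGnull, add_zero]
  exact le_antisymm (key X Y fun ω hω => (h ω hω).1) (key Y X fun ω hω => (h ω hω).2)

/-! ## The partition and the law -/

/-- **Partition by atoms**: for every event `E`, `P_q(E) = Σ_{(Q,(l,l'))} P_q(E ∩ atom Q l l')`. [this work] -/
theorem real_eq_sum_inter_atom (q : Sym2 (Fin (2 * K + 1)) → unitInterval) (E : Set (Set (Sym2 (Fin (2 * K + 1))))) :
    (prodBernoulli q).real E =
      ∑ ix ∈ (range K).powerset ×ˢ arcIx K, (prodBernoulli q).real (E ∩ atom K ix.1 ix.2.1 ix.2.2) := by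
  set I := (range K).powerset ×ˢ arcIx K with hI
  have hcov : E = ⋃ ix ∈ I, (E ∩ atom K ix.1 ix.2.1 ix.2.2) := by
    ext ω
    simp only [Set.mem_iUnion, Set.mem_inter_iff, exists_prop]
    constructor
    · intro hω
      exact ⟨(hairSet K ω, (firstClosed K ω, lastClosed K ω)), coords_mem ω, hω, mem_atom_self ω⟩
    · rintro ⟨_, _, hω, _⟩; exact hω
  have hdisj : (I : Set (Finset ℕ × ℕ × ℕ)).PairwiseDisjoint fun ix => E ∩ atom K ix.1 ix.2.1 ix.2.2 := by
    intro ix hix ix' hix' hne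
    have hix1 := Finset.mem_product.1 (Finset.mem_coe.1 hix)
    have hix2 := Finset.mem_product.1 (Finset.mem_coe.1 hix')
    have hd := atom_disjoint (K := K) (Finset.mem_powerset.1 hix1.1) hix1.2 (Finset.mem_powerset.1 hix2.1) hix2.2
      (by intro h; exact hne (Prod.ext_iff.2 ⟨(Prod.ext_iff.1 h).1, (Prod.ext_iff.1 h).2⟩))
    exact Disjoint.mono Set.inter_subset_right Set.inter_subset_right hd
  conv_lhs => rw [hcov]
  exact measureReal_biUnion_finset hdisj (fun _ _ => MeasurableSet.of_discrete)

end Summit.CriticalPhenomena.PercolationContinuityZ3.Theorems.HairyCycle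

end
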